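import Literature.NumberTheory.EllipticCurves.HeckeOperatorsGamma1QExpansionProofs
import Literature.NumberTheory.EllipticCurves.HeckeOperatorsDiamondCommProofs
import Literature.NumberTheory.EllipticCurves.CuspFormLFunction
import HarnessLib

/-!
# The real structure `f ↦ f^ε = conj f(-z̄)` of `S_k(Γ₁(N))` (Shimura 1971, proof of Thm. 3.48)

For a cusp form `f ∈ S_k(Γ₁(N))` put `f^ε(z) = \overline{f(-z̄)}`; in Mathlib's slash action of
`GL(2, ℝ)` (which lets matrices of negative determinant act through complex conjugation,
`UpperHalfPlane.σ`) this is `f ∣[k] J` with `J = diag(-1, 1)` (`UpperHalfPlane.J`,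
`UpperHalfPlane.coe_J_smul : J • τ = -conj τ`).  Shimura, *Introduction to the arithmetic theory of
automorphic functions* (1971), proof of Thm. 3.48 (p. 83): *"for `f ∈ S_k(Γ')`, put
`f^ε = \overline{f(-z̄)}`.  We see easily that `f^ε ∈ S_k(Γ')`, and `f^ε | [X]_k = (f | [X^ε]_k)^ε`
for every `X ∈ R(Γ', Δ)`.  Put `W = {f ∈ S_k(Γ') | f^ε = f}`.  Then `W` is an `ℝ`-linear subspace
of `S_k(Γ')`, and `S_k(Γ') = W ⊗_ℝ ℂ`"* — `W` is the space of forms with real Fourier coefficients,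
and it is this real structure (together with the Eichler–Shimura lattice (3.5.20)) that makes the
`ℚ`-span of the Hecke operators a `ℚ`-form of their `ℂ`-span (Thm. 3.48 (2), Thm. 3.51), whence
the integral bases of Thm. 3.52 / Deligne–Serre 1974, Prop. 2.7 (2.7.2).  This file supplies `ε`
on `S_k(Γ₁(N))` and the three properties used there; everything is proved.

## Main definitions and results (namespace `Literature.NumberTheory.EllipticCurves.ModularForms`)

* `jConj γ = J γ J = (a, -b; -c, d)` for `γ = (a b; c d) ∈ SL(2, ℤ)` (`mapGL_jConj`); it preserves
  `Γ₁(N)` and `Γ₀(N)` and the lower-right entry (`jConj_mem_Gamma1`, `jConj_mem_Gamma0`,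
  `gamma0Map_jConj`), so `J` normalises `Γ₁(N)` (`conjAct_J_gamma1`).
* `epsConj f = f ∣[k] J ∈ S_k(Γ₁(N))` (**definition**; `epsConj_apply : (epsConj f) τ = conj (f (J • τ))`),
  additive and conjugate-linear (`epsConj_add`, `epsConj_smul`), an involution (`epsConj_epsConj`).
* `cuspCoeff_epsConj`: **`aₙ(f^ε) = conj aₙ(f)`** (conjugate the `q`-expansion: `conj q(-z̄) = q(z)`),
  so `W = {f^ε = f}` is exactly the space of forms with real Fourier coefficients
  (`epsConj_eq_self_iff`).
* `epsConj_diamondOp`: **`(⟨d⟩ f)^ε = ⟨d⟩ f^ε`** (`⟨d⟩` is a slash by `σ_d ∈ Γ₀(N)` and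
  `J σ_d J ∈ Γ₀(N)` has the same lower-right entry);
  `epsConj_heckeT`: **`(T_p f)^ε = T_p f^ε`** for every prime `p` (compare `q`-expansions with
  Diamond–Shurman (5.3), `qExpansion_coeff_heckeT_gamma1_holds`, whose coefficients `1`, `p^{k-1}`
  are real).  These are Shimura's `f^ε|[X]_k = (f|[X^ε]_k)^ε` for `X = Γ₁(N) diag(1,p) Γ₁(N)`,
  `Γ₁(N) σ_d Γ₁(N)`, both of which satisfy `X^ε = X`.

## References

* G. Shimura, *Introduction to the arithmetic theory of automorphic functions*, Publ. Math. Soc.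
  Japan 11 (1971), proof of Thm. 3.48 (the involution `ε`, the real form `W`), (3.5.19).
* F. Diamond, J. Shurman, *A first course in modular forms*, GTM 228 (2005), §5.2 (diamond
  operators), Prop. 5.3.1 / (5.3) (`q`-expansion of `T_p`).
-/

noncomputable section

open scoped MatrixGroups ModularForm ComplexConjugate

open CongruenceSubgroup UpperHalfPlane Matrix.SpecialLinearGroup ConjAct Pointwise

namespace Literature.NumberTheory.EllipticCurves.ModularForms

/-! ### `J = diag(-1, 1)` normalises `Γ₁(N)` -/

section JConj

variable {N : ℕ}

/-- `γ ↦ J γ J` on `SL(2, ℤ)`, `J = diag(-1, 1)`: `(a b; c d) ↦ (a, -b; -c, d)` (Shimura 1971,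
(3.5.19): `X ↦ X^ε = ε X ε`). [folklore] -/
def jConj (γ : SL(2, ℤ)) : SL(2, ℤ) :=
  ⟨!![γ 0 0, -γ 0 1; -γ 1 0, γ 1 1], by
    have h := Matrix.det_fin_two (γ : Matrix (Fin 2) (Fin 2) ℤ)
    rw [γ.det_coe] at h
    rw [Matrix.det_fin_two_of]
    linarith⟩

/-- Upper-left entry of `J γ J`. [folklore] -/
@[simp] lemma jConj_apply_00 (γ : SL(2, ℤ)) : jConj γ 0 0 = γ 0 0 := rfl

/-- Upper-right entry of `J γ J`. [folklore] -/
@[simp] lemma jConj_apply_01 (γ : SL(2, ℤ)) : jConj γ 0 1 = -γ 0 1 := rfl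

/-- Lower-left entry of `J γ J`. [folklore] -/
@[simp] lemma jConj_apply_10 (γ : SL(2, ℤ)) : jConj γ 1 0 = -γ 1 0 := rfl

/-- Lower-right entry of `J γ J`. [folklore] -/
@[simp] lemma jConj_apply_11 (γ : SL(2, ℤ)) : jConj γ 1 1 = γ 1 1 := rfl

/-- `J γ J` computed in `GL(2, ℝ)`: `mapGL ℝ (jConj γ) = J · mapGL ℝ γ · J`. [folklore] -/
lemma mapGL_jConj (γ : SL(2, ℤ)) :
    (mapGL ℝ (jConj γ) : GL (Fin 2) ℝ) = J * mapGL ℝ γ * J := by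
  ext i j
  fin_cases i <;> fin_cases j <;>
    simp [Matrix.mul_apply, Fin.sum_univ_two, Units.val_mul, Matrix.vecMul, dotProduct]

/-- `jConj` preserves `Γ₁(N)`. [folklore] -/
lemma jConj_mem_Gamma1 {γ : SL(2, ℤ)} (hγ : γ ∈ Gamma1 N) : jConj γ ∈ Gamma1 N := by
  rw [Gamma1_mem] at hγ ⊢
  refine ⟨?_, ?_, ?_⟩
  · simpa using hγ.1
  · simpa using hγ.2.1
  · simp [hγ.2.2]

/-- `jConj` preserves `Γ₀(N)`. [folklore] -/
lemma jConj_mem_Gamma0 {γ : SL(2, ℤ)} (hγ : γ ∈ Gamma0 N) : jConj γ ∈ Gamma0 N := by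
  rw [Gamma0_mem] at hγ ⊢
  simp [hγ]

/-- `jConj` does not change the lower-right entry: `Gamma0Map (J γ J) = Gamma0Map γ`. [folklore] -/
lemma gamma0Map_jConj (γ : Gamma0 N) :
    Gamma0Map N ⟨jConj γ, jConj_mem_Gamma0 γ.2⟩ = Gamma0Map N γ := rfl

/-- `J² = 1` in `GL(2, ℝ)`. [folklore] -/
lemma J_mul_J : (J * J : GL (Fin 2) ℝ) = 1 := by
  rw [← sq, J_sq]

/-- `J⁻¹ = J`. [folklore] -/
lemma J_inv : (J⁻¹ : GL (Fin 2) ℝ) = J :=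
  inv_eq_of_mul_eq_one_right J_mul_J

/-- `J` normalises the image of `Γ₁(N)` in `GL(2, ℝ)`: `J x J ∈ Γ₁(N)` for `x ∈ Γ₁(N)`. [folklore] -/
lemma J_mul_mul_J_mem_gamma1 {x : GL (Fin 2) ℝ} (hx : x ∈ (Gamma1 N : Subgroup (GL (Fin 2) ℝ))) :
    J * x * J ∈ (Gamma1 N : Subgroup (GL (Fin 2) ℝ)) := by
  obtain ⟨γ, hγ, rfl⟩ := hx
  exact ⟨jConj γ, jConj_mem_Gamma1 hγ, mapGL_jConj γ⟩

/-- `J⁻¹ Γ₁(N) J = Γ₁(N)` (as subgroups of `GL(2, ℝ)`), i.e. the level of `f ∣[k] J` is again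
`Γ₁(N)` (Shimura 1971, proof of Thm. 3.48: "`f^ε ∈ S_k(Γ')`"). [folklore] -/
lemma conjAct_J_gamma1 :
    toConjAct (J⁻¹ : GL (Fin 2) ℝ) • (Gamma1 N : Subgroup (GL (Fin 2) ℝ)) = Gamma1 N := by
  ext x
  rw [J_inv, Subgroup.mem_pointwise_smul_iff_inv_smul_mem, ← toConjAct_inv, J_inv, toConjAct_smul,
    J_inv]
  refine ⟨fun h ↦ ?_, J_mul_mul_J_mem_gamma1⟩
  have := J_mul_mul_J_mem_gamma1 h
  rwa [show J * (J * x * J) * J = x by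
    rw [← mul_assoc, ← mul_assoc, J_mul_J, one_mul, mul_assoc, J_mul_J, mul_one]] at this

end JConj

/-! ### The involution `f ↦ f^ε = f ∣[k] J` on `S_k(Γ₁(N))` -/

section EpsConj

variable {N : ℕ} {k : ℤ}

/-- **Shimura's `f^ε`**: for `f ∈ S_k(Γ₁(N))`, the cusp form `f^ε = f ∣[k] J`, i.e.
`f^ε(z) = \overline{f(-z̄)}` (`epsConj_apply`), again of level `Γ₁(N)` because `J = diag(-1, 1)`
normalises `Γ₁(N)` (`conjAct_J_gamma1`; holomorphy and vanishing at all cusps are Mathlib's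
`CuspForm.translate`).  Shimura 1971, proof of Thm. 3.48: "for `f ∈ S_k(Γ')`, put
`f^ε = \overline{f(-z̄)}`.  We see easily that `f^ε ∈ S_k(Γ')`". [cite: Shimura1971, proof of Thm. 3.48] -/
def epsConj (f : CuspForm (Gamma1 N) k) : CuspForm (Gamma1 N) k where
  toFun := ⇑f ∣[k] J
  slash_action_eq' γ hγ :=
    SlashInvariantFormClass.slash_action_eq (CuspForm.translate f J) γ
      (by rw [conjAct_J_gamma1]; exact hγ)
  holo' := (CuspForm.translate f J).holo'
  zero_at_cusps' hc :=
    (CuspForm.translate f J).zero_at_cusps' (by rw [conjAct_J_gamma1]; exact hc)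

/-- `f^ε = f ∣[k] J` as functions. [folklore] -/
@[simp] lemma coe_epsConj (f : CuspForm (Gamma1 N) k) : ⇑(epsConj f) = ⇑f ∣[k] J := rfl

/-- `f^ε(τ) = conj (f (J • τ))`, `J • τ = -conj τ`. [folklore] -/
lemma epsConj_apply (f : CuspForm (Gamma1 N) k) (τ : ℍ) : epsConj f τ = conj (f (J • τ)) := by
  rw [coe_epsConj, ModularForm.slash_apply]
  simp

/-- `ε` is additive. [folklore] -/
lemma epsConj_add (f g : CuspForm (Gamma1 N) k) : epsConj (f + g) = epsConj f + epsConj g := by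
  ext τ
  simp [epsConj_apply]

/-- `ε` is conjugate-linear: `(c f)^ε = conj(c) f^ε`. [folklore] -/
lemma epsConj_smul (c : ℂ) (f : CuspForm (Gamma1 N) k) : epsConj (c • f) = conj c • epsConj f := by
  ext τ
  simp [epsConj_apply]

/-- `0^ε = 0`. [folklore] -/
@[simp] lemma epsConj_zero : epsConj (0 : CuspForm (Gamma1 N) k) = 0 := by
  ext τ
  simp [epsConj_apply]

/-- `(-f)^ε = -f^ε`. [folklore] -/
lemma epsConj_neg (f : CuspForm (Gamma1 N) k) : epsConj (-f) = -epsConj f := by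
  ext τ
  simp [epsConj_apply]

/-- `(f - g)^ε = f^ε - g^ε`. [folklore] -/
lemma epsConj_sub (f g : CuspForm (Gamma1 N) k) : epsConj (f - g) = epsConj f - epsConj g := by
  rw [sub_eq_add_neg, epsConj_add, epsConj_neg, sub_eq_add_neg]

/-- `ε` commutes with finite sums. [folklore] -/
lemma epsConj_sum {ι : Type*} (s : Finset ι) (f : ι → CuspForm (Gamma1 N) k) :
    epsConj (∑ i ∈ s, f i) = ∑ i ∈ s, epsConj (f i) := by
  classical
  induction s using Finset.induction_on with
  | empty => simp
  | insert a s ha ih => rw [Finset.sum_insert ha, Finset.sum_insert ha, epsConj_add, ih]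

/-- `ε` is an involution: `(f^ε)^ε = f` (`J² = 1`). [folklore] -/
@[simp] lemma epsConj_epsConj (f : CuspForm (Gamma1 N) k) : epsConj (epsConj f) = f := by
  refine DFunLike.ext' ?_
  change (⇑f ∣[k] J) ∣[k] J = ⇑f
  rw [← SlashAction.slash_mul, J_mul_J, SlashAction.slash_one]

/-- `ε` is injective. [folklore] -/
lemma epsConj_injective : Function.Injective (epsConj (N := N) (k := k)) :=
  Function.LeftInverse.injective epsConj_epsConj

/-- `ε` is surjective. [folklore] -/
lemma epsConj_surjective : Function.Surjective (epsConj (N := N) (k := k)) :=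
  Function.RightInverse.surjective epsConj_epsConj

/-- `f^ε = 0 ↔ f = 0`. [folklore] -/
lemma epsConj_eq_zero_iff {f : CuspForm (Gamma1 N) k} : epsConj f = 0 ↔ f = 0 := by
  exact epsConj_injective.eq_iff' epsConj_zero

/-! ### `q`-expansion: `aₙ(f^ε) = conj aₙ(f)` -/

/-- `conj q(J • τ) = q(τ)` for `q = e^{2πiτ}`: `conj e^{2πi(-τ̄)} = e^{2πiτ}`. [folklore] -/
lemma conj_qParam_J_smul (τ : ℍ) : conj (Function.Periodic.qParam 1 ((J • τ : ℍ) : ℂ)) = Function.Periodic.qParam 1 (τ : ℂ) := by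
  rw [Function.Periodic.qParam, Function.Periodic.qParam, ← Complex.exp_conj, coe_J_smul]
  congr 1
  simp only [map_div₀, map_mul, map_ofNat, Complex.conj_ofReal, Complex.conj_I, map_neg,
    Complex.conj_conj]
  ring

variable [NeZero N]

/-- **`aₙ(f^ε) = \overline{aₙ(f)}`**: the Fourier coefficients of `f^ε(z) = \overline{f(-z̄)}` are the
complex conjugates of those of `f` (conjugate `f(-z̄) = ∑ aₙ e^{2πin(-z̄)}`; Shimura 1971, proof of
Thm. 3.48, where `W = {f = f^ε}` is the real form of forms with real coefficients). [folklore] -/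
theorem cuspCoeff_epsConj (f : CuspForm (Gamma1 N) k) (n : ℕ) :
    cuspCoeff (epsConj f) n = conj (cuspCoeff f n) := by
  have key : ∀ τ : ℍ,
      HasSum (fun m ↦ conj ((qExpansion 1 ⇑f).coeff m) • Function.Periodic.qParam 1 (τ : ℂ) ^ m) (epsConj f τ) := by
    intro τ
    have h := Complex.hasSum_conj'.mpr (HeckeTGamma1.hasSum_qExpansion_Gamma1 N k f (J • τ))
    rw [epsConj_apply]
    convert h using 2 with m
    rw [smul_eq_mul, smul_eq_mul, map_mul, map_pow, conj_qParam_J_smul]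
  exact (ModularFormClass.qExpansion_coeff_unique one_pos
    (HeckeTGamma1.one_mem_strictPeriods_Gamma1 N) key n).symm

/-- In terms of Mathlib's `qExpansion`: `(qExpansion 1 f^ε).coeff n = conj ((qExpansion 1 f).coeff n)`.
[folklore] -/
theorem qExpansion_coeff_epsConj (f : CuspForm (Gamma1 N) k) (n : ℕ) :
    (qExpansion 1 ⇑(epsConj f)).coeff n = conj ((qExpansion 1 ⇑f).coeff n) :=
  cuspCoeff_epsConj f n

/-- **Shimura's real form `W`**: `f^ε = f` iff all Fourier coefficients of `f` are real
(Shimura 1971, proof of Thm. 3.48: `W = {f ∈ S_k(Γ') | f^ε = f}`). [cite: Shimura1971, proof of Thm. 3.48] -/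
theorem epsConj_eq_self_iff (f : CuspForm (Gamma1 N) k) :
    epsConj f = f ↔ ∀ n, conj (cuspCoeff f n) = cuspCoeff f n := by
  rw [eq_iff_forall_cuspCoeff_eq (HeckeTGamma1.one_mem_strictPeriods_Gamma1 N)]
  simp only [cuspCoeff_epsConj]

/-! ### `ε` commutes with the diamond and Hecke operators -/

/-- For a non-unit `d`, `diamondOp N k d` is the identity (the junk value of the definition). [folklore] -/
theorem diamondOp_of_not_isUnit {d : ZMod N} (hd : ¬ IsUnit d) : diamondOp N k d = LinearMap.id := by
  have h : ¬ ∃ γ : Gamma0 N, Gamma0Map N γ = d := by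
    rintro ⟨γ, rfl⟩
    exact hd ((Group.isUnit γ).map (Gamma0Map N))
  rw [diamondOp, dif_neg h]

/-- **`(⟨d⟩ f)^ε = ⟨d⟩ f^ε`**: with `σ ∈ Γ₀(N)` a lift of `d`, `(f|σ)|J = f|(σJ) = (f|J)|(JσJ)` and
`JσJ ∈ Γ₀(N)` has the same lower-right entry `d` (Shimura 1971, proof of Thm. 3.48:
`f^ε|[X]_k = (f|[X^ε]_k)^ε` with `X = Γ₁(N) σ Γ₁(N) = X^ε`). [cite: Shimura1971, proof of Thm. 3.48] -/
theorem epsConj_diamondOp (d : ZMod N) (f : CuspForm (Gamma1 N) k) :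
    epsConj (diamondOp N k d f) = diamondOp N k d (epsConj f) := by
  -- `⟨d⟩ F = F ∣[k] γ` for any lift `γ ∈ Γ₀(N)` of `d` (Diamond–Shurman §5.2, p. 168; the tree's
  -- `coe_diamondOp_gamma0Map`, restated here to keep the imports of this file small)
  have hslash : ∀ (γ : Gamma0 N) (F : CuspForm (Gamma1 N) k),
      (⇑(diamondOp N k (Gamma0Map N γ) F) : ℍ → ℂ) = ⇑F ∣[k] (mapGL ℝ (γ : SL(2, ℤ))) := by
    intro γ F
    have h : ∃ γ' : Gamma0 N, Gamma0Map N γ' = Gamma0Map N γ := ⟨γ, rfl⟩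
    rw [diamondOp, dif_pos h, coe_cuspHeckeOperatorₗ_gamma1]
    exact slash_mapGL_eq_of_Gamma0Map_eq N k h.choose_spec F
  by_cases hd : IsUnit d
  · obtain ⟨γ, rfl⟩ := exists_gamma0Map_eq_holds N hd
    refine DFunLike.ext' ?_
    rw [← gamma0Map_jConj γ, hslash, gamma0Map_jConj, coe_epsConj, coe_epsConj, hslash,
      ← SlashAction.slash_mul, ← SlashAction.slash_mul]
    change ⇑f ∣[k] (mapGL ℝ (γ : SL(2, ℤ)) * J) = ⇑f ∣[k] (J * mapGL ℝ (jConj (γ : SL(2, ℤ))))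
    rw [mapGL_jConj, ← mul_assoc, ← mul_assoc, J_mul_J, one_mul]
  · rw [diamondOp_of_not_isUnit hd, LinearMap.id_apply, LinearMap.id_apply]

/-- **`(T_p f)^ε = T_p f^ε`** for every prime `p` (`U_p` for `p ∣ N` included): both sides have
`n`-th Fourier coefficient `\overline{a_{pn}(f)} + 𝟙_N(p) p^{k-1} \overline{a_{n/p}(⟨p⟩ f)}` by the
`q`-expansion formula (Diamond–Shurman (5.3), `qExpansion_coeff_heckeT_gamma1_holds`),
`cuspCoeff_epsConj` and `epsConj_diamondOp` (Shimura 1971, proof of Thm. 3.48: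
`f^ε|[X]_k = (f|[X^ε]_k)^ε`, `X = Γ₁(N) diag(1,p) Γ₁(N) = X^ε`). [cite: Shimura1971, proof of Thm. 3.48] -/
theorem epsConj_heckeT (p : ℕ) [NeZero p] (hp : p.Prime) (f : CuspForm (Gamma1 N) k) :
    epsConj (heckeT (Gamma1 N) k p f) = heckeT (Gamma1 N) k p (epsConj f) := by
  refine eq_of_forall_cuspCoeff_eq (HeckeTGamma1.one_mem_strictPeriods_Gamma1 N) fun n ↦ ?_
  rw [cuspCoeff_epsConj]
  change conj ((qExpansion 1 ⇑(heckeT (Gamma1 N) k p f)).coeff n) =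
    (qExpansion 1 ⇑(heckeT (Gamma1 N) k p (epsConj f))).coeff n
  rw [qExpansion_coeff_heckeT_gamma1_holds N k f p hp n,
    qExpansion_coeff_heckeT_gamma1_holds N k (epsConj f) p hp n, ← epsConj_diamondOp,
    qExpansion_coeff_epsConj, qExpansion_coeff_epsConj]
  simp only [map_add, map_mul, apply_ite conj, map_zero, map_zpow₀, map_natCast]

end EpsConj

end Literature.NumberTheory.EllipticCurves.ModularForms
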